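import Summits.ResolutionOfSingularities.ResolutionOfSingularities.Theorems.FrobeniusLadderFInjectiveMacaulayficationPencilExitTagDeep
import HarnessLib

/-!
# TASK 4b SOUNDNESS, code 3 of ✓p694236 («pencil, j = (p−1)/2», per-letter `M₁ i + M₂ i ≤ 2` on `Z`): the `W`-chart is FULL at EVERY point `(w₀; c)` of the fibre line and the `U`-chart at
# the pole `(0; c)`, `p` odd, when `χ = y^r − y^s` is a unit along `Z` (one-unit case, or two-unit with `χ(c) ≠ 0`)
# (crux `FInjectiveMacaulayfication` stmt-ResolutionOfSingularities-15315, chain w45a; RULING R23.8 (3), plan-1 ACK l.85626; consumer res-L1-w45a-stub-3 TASK 4c; seat res-L1-w45a-stub-1 g15)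

[OURS · L1 W4.5a] Support file (`--supports stmt-ResolutionOfSingularities-15315 --as helper`); theorems only; unconditional; any field, every odd prime `p`. Nothing of the crux is
proved; no census row is asserted. AI-written (AI review is weaker than expert review).

LETTER as in ✓p696297 (`W = X 0`, base letters `X i.succ`, closed point `(w₀; c)`, orbit `Z = {c = 0}`). WITNESS: `J = (p−1)/2`, the monomial `W^J·y^{J(M₁+M₂)|_Z}` of the reduced Fedder
element; its coefficient is `C(p−1, J)·(−1)^J·α^J·(β·χ̃(0))^J` where `χ̃(0)` = the constant term of `χ` after the substitution (`= ±ρ, ∓σ` in the one-unit case, `= χ(c)` in the two-unit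
case); the `w₀`-terms cannot reach it because at a letter `i₀ ∈ Z` with `M₁ i₀ = 2` its exponent is `2J = p − 1 < (J+1)·2` (✓p699538 `coeff_mul_pow_shift_eq`); if `M₁|_Z ≤ 1` the
claim is ✓p696297 (code 2). At the pole no shift occurs and no case split is needed.
* §1 `theta0_chi`, `constantCoeff_theta0_chi`, `constantCoeff_theta0_chi_ne_zero_of_oneUnit`, `…_of_twoUnit`, `two_mul_half`; §2 ★★ `fullCl_pencilChartW_code3_core` (hypothesis: the
  constant term of `χ̃` is non-zero), ★★ `fullCl_pencilChartW_code3` (one-unit), ★★ `fullCl_pencilChartW_code3_twoUnit` (`r|_Z = s|_Z = 0`, `χ(c) ≠ 0`); §3 the pole twins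
  ★★ `fullCl_pencilChartU_pole_code3_core / _code3 / _code3_twoUnit`. The two-unit points with `χ(c) = 0` need the transversal letter (separate file).
[cite: Fedder1983, Thm. 1.12]
-/

set_option linter.dupNamespace false

noncomputable section

open AlgebraicGeometry IsLocalRing MvPolynomial
open scoped Pointwise

namespace Summit.ResolutionOfSingularities.ResolutionOfSingularities.Theorems.FInjectiveMacaulayfication.PencilExitTagCode3

open Summit.ResolutionOfSingularities.ResolutionOfSingularities.Theorems.FInjectiveMacaulayfication
open SliceableCentre PencilExitTagW PencilExitWitness

variable (k : Type) [Field k] {n : ℕ}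

/-! ## §1 The substitution on `χ = y^r − y^s` -/

/-- `θ₀(y^r − y^s) = ρ·y^{r|_Z} − σ·y^{s|_Z}`. [plumbing] -/
theorem theta0_chi [DecidableEq k] (c : Fin n → k) (r s : Fin n →₀ ℕ) :
    aeval (fun i : Fin n => if c i = 0 then (X i : MvPolynomial (Fin n) k) else C (c i)) (monomial r (1 : k) - monomial s 1) =
      C (∏ i ∈ r.support with c i ≠ 0, c i ^ r i) * monomial (r.filter fun i => c i = 0) 1 -
        C (∏ i ∈ s.support with c i ≠ 0, c i ^ s i) * monomial (s.filter fun i => c i = 0) 1 := by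
  rw [map_sub, theta0_monomial, theta0_monomial]

/-- `v|_Z = 0 ⟺ v` vanishes on `Z`. [plumbing] -/
theorem filter_eq_zero_iff [DecidableEq k] (c : Fin n → k) (v : Fin n →₀ ℕ) : (v.filter fun i => c i = 0) = 0 ↔ ∀ i, c i = 0 → v i = 0 := by
  constructor
  · intro h i hci; have := DFunLike.congr_fun h i; rwa [Finsupp.filter_apply_pos (fun i => c i = 0) v hci] at this
  · intro h; ext i
    by_cases hci : c i = 0
    · rw [Finsupp.filter_apply_pos (fun i => c i = 0) v hci, h i hci]; rfl
    · rw [Finsupp.filter_apply_neg (fun i => c i = 0) v hci]; rfl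

/-- **The constant term of `θ₀(χ)`**: `ρ·[r|_Z = 0] − σ·[s|_Z = 0]`. [plumbing] -/
theorem constantCoeff_theta0_chi [DecidableEq k] (c : Fin n → k) (r s : Fin n →₀ ℕ) :
    constantCoeff (aeval (fun i : Fin n => if c i = 0 then (X i : MvPolynomial (Fin n) k) else C (c i)) (monomial r (1 : k) - monomial s 1)) =
      (if ∀ i, c i = 0 → r i = 0 then ∏ i ∈ r.support with c i ≠ 0, c i ^ r i else 0) -
        (if ∀ i, c i = 0 → s i = 0 then ∏ i ∈ s.support with c i ≠ 0, c i ^ s i else 0) := by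
  rw [theta0_chi, map_sub, map_mul, map_mul, constantCoeff_C, constantCoeff_C, constantCoeff_monomial, constantCoeff_monomial]
  simp only [filter_eq_zero_iff, mul_ite, mul_one, mul_zero]

/-- **ONE-UNIT CASE**: exactly one of `y^r`, `y^s` is a unit along `Z` ⇒ the constant term of `θ₀(χ)` is `ρ` or `−σ`, non-zero. [plumbing] -/
theorem constantCoeff_theta0_chi_ne_zero_of_oneUnit [DecidableEq k] (c : Fin n → k) (r s : Fin n →₀ ℕ)
    (hunit : (∀ i, c i = 0 → r i = 0) ↔ ¬ (∀ i, c i = 0 → s i = 0)) :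
    constantCoeff (aeval (fun i : Fin n => if c i = 0 then (X i : MvPolynomial (Fin n) k) else C (c i)) (monomial r (1 : k) - monomial s 1)) ≠ 0 := by
  rw [constantCoeff_theta0_chi]
  by_cases hr : ∀ i, c i = 0 → r i = 0
  · rw [if_pos hr, if_neg (hunit.1 hr), sub_zero]; exact theta0_scalar_ne_zero k c r
  · have hs : ∀ i, c i = 0 → s i = 0 := by by_contra h; exact hr (hunit.2 h)
    rw [if_neg hr, if_pos hs, zero_sub]; exact neg_ne_zero.2 (theta0_scalar_ne_zero k c s)

/-- **TWO-UNIT CASE with `χ(c) ≠ 0`**: `r|_Z = s|_Z = 0` ⇒ the constant term of `θ₀(χ)` is `χ(c) = c^r − c^s`. [plumbing] -/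
theorem constantCoeff_theta0_chi_ne_zero_of_twoUnit [DecidableEq k] (c : Fin n → k) (r s : Fin n →₀ ℕ)
    (hr0 : ∀ i, c i = 0 → r i = 0) (hs0 : ∀ i, c i = 0 → s i = 0) (hχ : eval c (monomial r (1 : k) - monomial s 1) ≠ 0) :
    constantCoeff (aeval (fun i : Fin n => if c i = 0 then (X i : MvPolynomial (Fin n) k) else C (c i)) (monomial r (1 : k) - monomial s 1)) ≠ 0 := by
  have hprod : ∀ v : Fin n →₀ ℕ, (∀ i, c i = 0 → v i = 0) → (∏ i ∈ v.support with c i ≠ 0, c i ^ v i) = eval c (monomial v (1 : k)) := fun v hv => by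
    have hF : Finset.filter (fun i => c i ≠ 0) v.support = v.support :=
      Finset.filter_eq_self.2 fun i hi hci => (Finsupp.mem_support_iff.1 hi) (hv i hci)
    rw [eval_monomial, one_mul, Finsupp.prod, hF]
  rw [constantCoeff_theta0_chi, if_pos hr0, if_pos hs0, hprod r hr0, hprod s hs0, ← map_sub]
  exact hχ

/-- `p − 1 = 2·((p−1)/2)` for an odd prime. [plumbing] -/
theorem two_mul_half (p : ℕ) [Fact p.Prime] (hp2 : p ≠ 2) : 2 * ((p - 1) / 2) = p - 1 :=
  Nat.two_mul_div_two_of_even ((Fact.out : p.Prime).even_sub_one hp2)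

/-! ## §2 ★★ Code 3, `W`-chart, every `w₀` -/

/-- ★★ **CODE 3 CORE, `W`-chart**: `Φ_W = (y^{M₁})⁺·W − (y^{M₂}(y^r − y^s))⁺` (`M₁ ⊥ M₂`, `p` odd) is FULL at EVERY closed point `(w₀; c)` with `M₁ i + M₂ i ≤ 2` on `Z` when the
constant term of `θ₀(y^r − y^s)` is non-zero. Witness `W^J·y^{J(M₁+M₂)|_Z}`, `J = (p−1)/2`. [OURS · TASK 4b soundness; cite: Fedder1983, Thm. 1.12] -/
theorem fullCl_pencilChartW_code3_core (p : ℕ) [Fact p.Prime] [CharP k p] (hp2 : p ≠ 2) [DecidableEq k] (M₁ M₂ r s : Fin n →₀ ℕ) (hdisj : ∀ i, M₁ i = 0 ∨ M₂ i = 0)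
    (Φ : MvPolynomial (Fin (n + 1)) k)
    (hΦ : Φ = rename Fin.succ (monomial M₁ (1 : k)) * X 0 - rename Fin.succ (monomial M₂ (1 : k) * (monomial r 1 - monomial s 1))) (hΦp : Prime Φ)
    (c : Fin n → k) (w₀ : k) (y : Spec (.of (MvPolynomial (Fin (n + 1)) k ⧸ Ideal.span {Φ}))) (hy : y.asIdeal.IsMaximal)
    (ha : y.asIdeal.comap (Ideal.Quotient.mk (Ideal.span {Φ})) =
      Ideal.span (Set.range (Fin.cons ((X 0 : MvPolynomial (Fin (n + 1)) k) - C w₀) fun i : Fin n => X i.succ - C (c i))))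
    (htag : ∀ i, c i = 0 → M₁ i + M₂ i ≤ 2)
    (hχ0 : constantCoeff (aeval (fun i : Fin n => if c i = 0 then (X i : MvPolynomial (Fin n) k) else C (c i)) (monomial r (1 : k) - monomial s 1)) ≠ 0) :
    FullCl p ((Spec (.of (MvPolynomial (Fin (n + 1)) k ⧸ Ideal.span {Φ}))).presheaf.stalk y) := by
  -- if `M₁|_Z ≤ 1` this is code 2
  by_cases hM₁ : ∀ i, c i = 0 → M₁ i ≤ 1
  · exact fullCl_pencilChartW_of_M₁_le_one k p M₁ _ Φ hΦ hΦp c w₀ y hy ha hM₁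
  push Not at hM₁
  obtain ⟨i₀, hci₀, hM₁i₀⟩ := hM₁
  have hM₂i₀ : M₂ i₀ = 0 := (hdisj i₀).resolve_left (by omega)
  have hp1 : 1 ≤ p := (Fact.out : p.Prime).one_lt.le
  have hJ := two_mul_half p hp2
  set J := (p - 1) / 2 with hJdef
  set v₀ : Fin n → MvPolynomial (Fin n) k := fun i => if c i = 0 then X i else C (c i) with hv₀
  set a := M₁.filter fun i => c i = 0 with ha'
  set b := M₂.filter fun i => c i = 0 with hb
  set α : k := ∏ i ∈ M₁.support with c i ≠ 0, c i ^ M₁ i with hα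
  set β : k := ∏ i ∈ M₂.support with c i ≠ 0, c i ^ M₂ i with hβ
  set χ' : MvPolynomial (Fin n) k := aeval v₀ (monomial r (1 : k) - monomial s 1) with hχ'
  have hα0 : α ≠ 0 := theta0_scalar_ne_zero k c M₁
  have hβ0 : β ≠ 0 := theta0_scalar_ne_zero k c M₂
  have hA : aeval v₀ (monomial M₁ (1 : k)) = monomial a 1 * C α := by rw [hv₀, theta0_monomial, mul_comm]
  have hB : aeval v₀ (monomial M₂ (1 : k) * (monomial r 1 - monomial s 1)) = monomial b (1 : k) * (C β * χ') := by
    rw [map_mul, hχ', hv₀, theta0_monomial]; ring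
  set d₀ : Fin n →₀ ℕ := J • a + J • b with hd₀
  refine fullCl_linearChart_of_subst k p _ _ Φ hΦ hΦp c w₀ y hy ha v₀ {i | c i = 0} (PencilExitTagDeep.v0_shape k c) J (by omega) d₀ (fun i hci => ?_) ?_
  · rw [Set.mem_setOf_eq] at hci
    rw [hd₀, Finsupp.add_apply, Finsupp.smul_apply, Finsupp.smul_apply, hb, ha', Finsupp.filter_apply_pos (fun i => c i = 0) M₁ hci,
      Finsupp.filter_apply_pos (fun i => c i = 0) M₂ hci, smul_eq_mul, smul_eq_mul, ← Nat.mul_add]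
    calc J * (M₁ i + M₂ i) ≤ J * 2 := Nat.mul_le_mul_left _ (htag i hci)
      _ < p := by omega
  · rw [hA, hB, show p - 1 - J = J by omega]
    rw [coeff_mul_pow_shift_eq k a (C α) (monomial b (1 : k) * (C β * χ')) w₀ J J d₀
      ⟨i₀, by
        rw [hd₀, Finsupp.add_apply, Finsupp.smul_apply, Finsupp.smul_apply, hb, ha', Finsupp.filter_apply_pos (fun i => c i = 0) M₁ hci₀,
          Finsupp.filter_apply_pos (fun i => c i = 0) M₂ hci₀, hM₂i₀, smul_eq_mul, smul_zero, add_zero, Nat.succ_mul]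
        omega⟩]
    rw [hd₀, coeff_pencil_target, constantCoeff_C, map_mul, constantCoeff_C]
    exact mul_ne_zero (mul_ne_zero (pow_ne_zero _ (neg_ne_zero.2 one_ne_zero)) (pow_ne_zero _ hα0)) (pow_ne_zero _ (mul_ne_zero hβ0 hχ0))

/-- ★★ **CODE 3, ONE-UNIT CASE**: `Φ_W` is FULL at every `(w₀; c)` with `M₁ i + M₂ i ≤ 2` on `Z` when exactly one of `y^r`, `y^s` is a unit along `Z` (`p` odd; `M₁ ⊥ M₂`; `Φ_W` prime by
✓ `PencilPhiPrime.prime_pencilPhiW`). All 4 code-3 pairs of ✓p694236 are of this kind. [OURS · TASK 4b soundness; cite: Fedder1983, Thm. 1.12] -/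
theorem fullCl_pencilChartW_code3 (p : ℕ) [Fact p.Prime] [CharP k p] (hp2 : p ≠ 2) (M₁ M₂ r s : Fin n →₀ ℕ) (hdisj : ∀ i, M₁ i = 0 ∨ M₂ i = 0)
    (Φ : MvPolynomial (Fin (n + 1)) k)
    (hΦ : Φ = rename Fin.succ (monomial M₁ (1 : k)) * X 0 - rename Fin.succ (monomial M₂ (1 : k) * (monomial r 1 - monomial s 1))) (hΦp : Prime Φ)
    (c : Fin n → k) (w₀ : k) (y : Spec (.of (MvPolynomial (Fin (n + 1)) k ⧸ Ideal.span {Φ}))) (hy : y.asIdeal.IsMaximal)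
    (ha : y.asIdeal.comap (Ideal.Quotient.mk (Ideal.span {Φ})) =
      Ideal.span (Set.range (Fin.cons ((X 0 : MvPolynomial (Fin (n + 1)) k) - C w₀) fun i : Fin n => X i.succ - C (c i))))
    (htag : ∀ i, c i = 0 → M₁ i + M₂ i ≤ 2)
    (hunit : (∀ i, c i = 0 → r i = 0) ↔ ¬ (∀ i, c i = 0 → s i = 0)) :
    FullCl p ((Spec (.of (MvPolynomial (Fin (n + 1)) k ⧸ Ideal.span {Φ}))).presheaf.stalk y) := by
  classical
  exact fullCl_pencilChartW_code3_core k p hp2 M₁ M₂ r s hdisj Φ hΦ hΦp c w₀ y hy ha htag (constantCoeff_theta0_chi_ne_zero_of_oneUnit k c r s hunit)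

/-- ★★ **CODE 3, TWO-UNIT CASE AT `χ(c) ≠ 0`**: `Φ_W` is FULL at every `(w₀; c)` with `M₁ i + M₂ i ≤ 2` on `Z` when `r|_Z = s|_Z = 0` and `c^r ≠ c^s` (`p` odd; `M₁ ⊥ M₂`).
[OURS · TASK 4b soundness; cite: Fedder1983, Thm. 1.12] -/
theorem fullCl_pencilChartW_code3_twoUnit (p : ℕ) [Fact p.Prime] [CharP k p] (hp2 : p ≠ 2) (M₁ M₂ r s : Fin n →₀ ℕ) (hdisj : ∀ i, M₁ i = 0 ∨ M₂ i = 0)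
    (Φ : MvPolynomial (Fin (n + 1)) k)
    (hΦ : Φ = rename Fin.succ (monomial M₁ (1 : k)) * X 0 - rename Fin.succ (monomial M₂ (1 : k) * (monomial r 1 - monomial s 1))) (hΦp : Prime Φ)
    (c : Fin n → k) (w₀ : k) (y : Spec (.of (MvPolynomial (Fin (n + 1)) k ⧸ Ideal.span {Φ}))) (hy : y.asIdeal.IsMaximal)
    (ha : y.asIdeal.comap (Ideal.Quotient.mk (Ideal.span {Φ})) =
      Ideal.span (Set.range (Fin.cons ((X 0 : MvPolynomial (Fin (n + 1)) k) - C w₀) fun i : Fin n => X i.succ - C (c i))))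
    (htag : ∀ i, c i = 0 → M₁ i + M₂ i ≤ 2)
    (hr0 : ∀ i, c i = 0 → r i = 0) (hs0 : ∀ i, c i = 0 → s i = 0) (hχ : eval c (monomial r (1 : k) - monomial s 1) ≠ 0) :
    FullCl p ((Spec (.of (MvPolynomial (Fin (n + 1)) k ⧸ Ideal.span {Φ}))).presheaf.stalk y) := by
  classical
  exact fullCl_pencilChartW_code3_core k p hp2 M₁ M₂ r s hdisj Φ hΦ hΦp c w₀ y hy ha htag (constantCoeff_theta0_chi_ne_zero_of_twoUnit k c r s hr0 hs0 hχ)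

/-! ## §3 ★★ Code 3 at the pole `U = 0` -/

/-- ★★ **CODE 3 CORE AT THE POLE**: `Φ_U = (y^{M₂}(y^r − y^s))⁺·U − (y^{M₁})⁺` is FULL at `(0; c)` with `M₁ i + M₂ i ≤ 2` on `Z` when the constant term of `θ₀(y^r − y^s)` is non-zero
(`p` odd; no disjointness needed). Witness `U^J·y^{J(M₁+M₂)|_Z}`. [OURS · TASK 4b soundness; cite: Fedder1983, Thm. 1.12] -/
theorem fullCl_pencilChartU_pole_code3_core (p : ℕ) [Fact p.Prime] [CharP k p] (hp2 : p ≠ 2) [DecidableEq k] (M₁ M₂ r s : Fin n →₀ ℕ)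
    (Φ : MvPolynomial (Fin (n + 1)) k)
    (hΦ : Φ = rename Fin.succ (monomial M₂ (1 : k) * (monomial r 1 - monomial s 1)) * X 0 - rename Fin.succ (monomial M₁ (1 : k))) (hΦp : Prime Φ)
    (c : Fin n → k) (y : Spec (.of (MvPolynomial (Fin (n + 1)) k ⧸ Ideal.span {Φ}))) (hy : y.asIdeal.IsMaximal)
    (ha : y.asIdeal.comap (Ideal.Quotient.mk (Ideal.span {Φ})) =
      Ideal.span (Set.range (Fin.cons (X 0 : MvPolynomial (Fin (n + 1)) k) fun i : Fin n => X i.succ - C (c i))))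
    (htag : ∀ i, c i = 0 → M₁ i + M₂ i ≤ 2)
    (hχ0 : constantCoeff (aeval (fun i : Fin n => if c i = 0 then (X i : MvPolynomial (Fin n) k) else C (c i)) (monomial r (1 : k) - monomial s 1)) ≠ 0) :
    FullCl p ((Spec (.of (MvPolynomial (Fin (n + 1)) k ⧸ Ideal.span {Φ}))).presheaf.stalk y) := by
  have hp1 : 1 ≤ p := (Fact.out : p.Prime).one_lt.le
  have hJ := two_mul_half p hp2
  set J := (p - 1) / 2 with hJdef
  set v₀ : Fin n → MvPolynomial (Fin n) k := fun i => if c i = 0 then X i else C (c i) with hv₀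
  set a := M₁.filter fun i => c i = 0 with ha'
  set b := M₂.filter fun i => c i = 0 with hb
  set α : k := ∏ i ∈ M₁.support with c i ≠ 0, c i ^ M₁ i with hα
  set β : k := ∏ i ∈ M₂.support with c i ≠ 0, c i ^ M₂ i with hβ
  set χ' : MvPolynomial (Fin n) k := aeval v₀ (monomial r (1 : k) - monomial s 1) with hχ'
  have hα0 : α ≠ 0 := theta0_scalar_ne_zero k c M₁
  have hβ0 : β ≠ 0 := theta0_scalar_ne_zero k c M₂
  have hA : aeval v₀ (monomial M₁ (1 : k)) = monomial a 1 * C α := by rw [hv₀, theta0_monomial, mul_comm]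
  have hB : aeval v₀ (monomial M₂ (1 : k) * (monomial r 1 - monomial s 1)) = monomial b (1 : k) * (C β * χ') := by
    rw [map_mul, hχ', hv₀, theta0_monomial]; ring
  set d₀ : Fin n →₀ ℕ := J • b + J • a with hd₀
  refine fullCl_linearChart_pole_of_subst k p _ _ Φ hΦ hΦp c y hy ha v₀ {i | c i = 0} (PencilExitTagDeep.v0_shape k c) J (by omega) d₀ (fun i hci => ?_) ?_
  · rw [Set.mem_setOf_eq] at hci
    rw [hd₀, Finsupp.add_apply, Finsupp.smul_apply, Finsupp.smul_apply, hb, ha', Finsupp.filter_apply_pos (fun i => c i = 0) M₁ hci,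
      Finsupp.filter_apply_pos (fun i => c i = 0) M₂ hci, smul_eq_mul, smul_eq_mul, ← Nat.mul_add, Nat.add_comm]
    calc J * (M₁ i + M₂ i) ≤ J * 2 := Nat.mul_le_mul_left _ (htag i hci)
      _ < p := by omega
  · rw [hA, hB, show p - 1 - J = J by omega, hd₀, coeff_pencil_target, constantCoeff_C, map_mul, constantCoeff_C]
    exact mul_ne_zero (mul_ne_zero (pow_ne_zero _ (neg_ne_zero.2 one_ne_zero)) (pow_ne_zero _ (mul_ne_zero hβ0 hχ0))) (pow_ne_zero _ hα0)

/-- ★★ **CODE 3 AT THE POLE, ONE-UNIT CASE.** [OURS · TASK 4b soundness; cite: Fedder1983, Thm. 1.12] -/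
theorem fullCl_pencilChartU_pole_code3 (p : ℕ) [Fact p.Prime] [CharP k p] (hp2 : p ≠ 2) (M₁ M₂ r s : Fin n →₀ ℕ)
    (Φ : MvPolynomial (Fin (n + 1)) k)
    (hΦ : Φ = rename Fin.succ (monomial M₂ (1 : k) * (monomial r 1 - monomial s 1)) * X 0 - rename Fin.succ (monomial M₁ (1 : k))) (hΦp : Prime Φ)
    (c : Fin n → k) (y : Spec (.of (MvPolynomial (Fin (n + 1)) k ⧸ Ideal.span {Φ}))) (hy : y.asIdeal.IsMaximal)
    (ha : y.asIdeal.comap (Ideal.Quotient.mk (Ideal.span {Φ})) =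
      Ideal.span (Set.range (Fin.cons (X 0 : MvPolynomial (Fin (n + 1)) k) fun i : Fin n => X i.succ - C (c i))))
    (htag : ∀ i, c i = 0 → M₁ i + M₂ i ≤ 2)
    (hunit : (∀ i, c i = 0 → r i = 0) ↔ ¬ (∀ i, c i = 0 → s i = 0)) :
    FullCl p ((Spec (.of (MvPolynomial (Fin (n + 1)) k ⧸ Ideal.span {Φ}))).presheaf.stalk y) := by
  classical
  exact fullCl_pencilChartU_pole_code3_core k p hp2 M₁ M₂ r s Φ hΦ hΦp c y hy ha htag (constantCoeff_theta0_chi_ne_zero_of_oneUnit k c r s hunit)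

/-- ★★ **CODE 3 AT THE POLE, TWO-UNIT CASE AT `χ(c) ≠ 0`.** [OURS · TASK 4b soundness; cite: Fedder1983, Thm. 1.12] -/
theorem fullCl_pencilChartU_pole_code3_twoUnit (p : ℕ) [Fact p.Prime] [CharP k p] (hp2 : p ≠ 2) (M₁ M₂ r s : Fin n →₀ ℕ)
    (Φ : MvPolynomial (Fin (n + 1)) k)
    (hΦ : Φ = rename Fin.succ (monomial M₂ (1 : k) * (monomial r 1 - monomial s 1)) * X 0 - rename Fin.succ (monomial M₁ (1 : k))) (hΦp : Prime Φ)
    (c : Fin n → k) (y : Spec (.of (MvPolynomial (Fin (n + 1)) k ⧸ Ideal.span {Φ}))) (hy : y.asIdeal.IsMaximal)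
    (ha : y.asIdeal.comap (Ideal.Quotient.mk (Ideal.span {Φ})) =
      Ideal.span (Set.range (Fin.cons (X 0 : MvPolynomial (Fin (n + 1)) k) fun i : Fin n => X i.succ - C (c i))))
    (htag : ∀ i, c i = 0 → M₁ i + M₂ i ≤ 2)
    (hr0 : ∀ i, c i = 0 → r i = 0) (hs0 : ∀ i, c i = 0 → s i = 0) (hχ : eval c (monomial r (1 : k) - monomial s 1) ≠ 0) :
    FullCl p ((Spec (.of (MvPolynomial (Fin (n + 1)) k ⧸ Ideal.span {Φ}))).presheaf.stalk y) := by
  classical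
  exact fullCl_pencilChartU_pole_code3_core k p hp2 M₁ M₂ r s Φ hΦ hΦp c y hy ha htag (constantCoeff_theta0_chi_ne_zero_of_twoUnit k c r s hr0 hs0 hχ)

end Summit.ResolutionOfSingularities.ResolutionOfSingularities.Theorems.FInjectiveMacaulayfication.PencilExitTagCode3

end
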